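import Mathlib
import Literature.NumberTheory.LFunctions.Zhang2022.SkeletonPartThree
import Literature.NumberTheory.LFunctions.Zhang2022.KappaLSeries
import HarnessLib

/-!
# Zhang (2022), typed manuscript, §16 part A: "Evaluation of `Φ₂`" — (16.1)–(16.12) and the
# un-numbered displays §16.u001–u026 (pp. 88–92, tex L4404–L4570)

Topic `Literature/NumberTheory/LFunctions/Zhang2022` (Landau–Siegel audit tree; verdict-neutral).
Y. Zhang, *Discrete mean estimates and the Landau–Siegel zero*, arXiv:2211.02515v1 (2022)
[Zhang2022LandauSiegel] — **an unrefereed manuscript under adjudication. Every `def … : Prop` below is a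
CLAIM OF THE MANUSCRIPT (a displayed step of §16), STATED NOT ASSERTED; nothing here asserts or denies
Theorems 1–2.** Campaign D-0069, layer L4, slice L4-t4 = file `TypedSection16A` (DAG nodes
`Z22:§16.u001 … Z22:§16.u026`, `Z22:(16.1) … Z22:(16.12)`); locators `[Z22 p.<PDF page>, (16.m), tex L<line>]`
read on the page (`pages/p0088–p0092.txt`) with formulas from the TeX source.

The section refines the skeleton's coarse deduction node `Skeleton.Ded1617` ((16.1)–(16.16) ⇒ (16.17) =
`Skeleton.Eval1617`): it takes `Φ₂` (13.9) = `Skeleton.Phi2`, applies Proposition 14.1 (`Skeleton.Prop141`,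
objects `Skeleton.Theta2`, `Skeleton.main141`) at `β = β₁` with `𝐤₂* = κ₂ ∗ b₁`, `𝐚₂* = g̃₂`, and reduces
`Φ₂(p)` to the sums `𝒮₂ⱼ` via the residues `ℛ₂*`, `ℛ₂ⱼ`. Part B (Lemmas 16.1–16.2, (16.13)–(16.17)) is the
sibling file `TypedSection16B`.

## What is here (one declaration per displayed item; objects = real `def`s, claims = `def … : Prop`)

* OBJECTS introduced by "Write/Let … be given by" (names per the L4 naming table, STATUS 23:30Z):
  `calK2` (𝒦₂(s,ψ), u001), `I3pm` (I₃^±(ψ), u003), `kappa2` (u006, = the tree's κ₂), `b1coef` (b₁, u007),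
  `gTilde16` (§16's g̃₂, u009 — NOT the g̃₂ of §11 = `Skeleton.gtilde2`), `kappa2Star` (κ₂* = κ₂∗b₁, u010),
  `Phi2p` (Φ₂(p), (16.3)), `kap2Ser` and `integrand16_4` ((16.4)), `kappaTilde2` (κ̃₂(d₁;r,s), u013), `lam2`
  (λ₂(n,s), u014), `calR2star` (ℛ₂*, u016), `calD2` (𝒟₂(d,l), u019), `xi2` (ξ₂(n;d,l), (16.7)), `lamTilde2`
  (λ̃₂(n,d), (16.8)), `integrand16_9` ((16.9)), `xi2LocalSeries`/`calM2Factor`/`calM2`/`calM2Series`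
  (ℳ₂(d,l;s), u021 — Euler product / printed series, see the TYPING NOTE there), `integrand16_u023` (u023),
  `F1611` ((16.11)), `calR2` (ℛ₂ⱼ, its residue at the simple pole `s = −β_j`, as `lim (s+β_j)·(16.11)`),
  `calS2` (𝒮₂ⱼ, u024), `calM2star` (ℳ₂*, u025/u026).
  `kappa2 c′ D` (u006) IS the tree's `MeanSquareMajorant.kappa₂ (Skeleton.b1 c′ D)` (`n^{−β₁} ∗ μ`), whose
  printed generating identity is the tree THEOREM `MeanSquareMajorant.LSeries_kappa₂` (with
  `beta1_eq_b1_mul_I` below for `β₁ = ib₁`); `κ₂ ∗ b₁` is the tree's `MeanSquareMajorant.conv`.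
* CLAIMS: `Step16_u002/u004/u005/u008/u010/u011/u012/u015/u017/u018/u020/u020mult/u021/u021an/u022/u023/u026`,
  `Eq16_1/2/4/5/5P/6/9/10/12`, `Eq16_u007` (the generating-series definition of `b₁` as an identity).
* GLUE (proved, `rfl`-level): `beta1_eq_b1_mul_I`, `beta2_eq_b2_mul_I`, `beta3_eq_b3_mul_I`.
* KERNEL-CHECKED LEAVES live in the theorem-only companion `TypedSection16ALeaves` (u008, u026, (16.6),
  u020's display; support facts `bcoef_eq_zero_of_le`, `b1coef_eq_zero_of_le`, `gTilde16_eq_zero_of_le`).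

## Conventions (skel/INTERFACE.md §3, plan/L4/ASSIGNMENTS.md §1)

"`X = Y + o(𝔓)`" ↦ `∀ ε > 0, ForAllLarge (… (A) → ‖X − Y‖ ≤ ε·𝔓)`; "`X = Y + O(ε)`", `ε = exp{−c𝓛¹⁰}` (§4 p. 19,
tex L1062) ↦ `∃ c > 0, ∃ C, ForAllLarge (… ≤ C·exp(−c𝓛¹⁰))`; `ε₁ = exp{−c𝓛^{1/10}}` (§7, tex L2128) likewise;
"`X ≪ Y`" ↦ `∃ C, …  ≤ C·Y`. `τ₂(n)` = `n.divisors.card`, `τ₃` = `ζ ∗ ζ ∗ ζ`. `Σ_{p∼P}Σ*_{ψ (mod p)}` (all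
primitive `ψ` to prime moduli in the window) = `∑ᶠ x : Chr D`. Vertical-line integrals
`(1/2πi)∫_{(c)} F(s)ds` are written in the tree's house style `(1/(2π))∫_ℝ F(c + it) dt` with a named
integrand; residues at simple poles as `limUnder (𝓝[≠] z₀) ((s − z₀)·F s)` (L4 convention). Exact
rearrangement identities are stated under `ForAllLarge` without (A); analytic claims carry (A) (in force
from §5 on). Finite sums are typed over explicit ranges containing the support of the summand (documented
at each decl). Visible print defects are typed AS PRINTED and flagged (`PRINT:`); for (16.5) ("`+ o(1)`")
and u010 ("`+ o(p)`") the evidently intended scale is typed as a second decl / noted, never substituted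
silently.

## References

* Y. Zhang, arXiv:2211.02515v1 (2022), §16 pp. 88–92, (16.1)–(16.12); §13 (13.5), (13.9); §14
  Prop. 14.1; §15 (15.1)–(15.15) (the parallel computation for `Φ₁`); §7 (7.17), (7.19); §5 (5.15).
  [cite: Zhang2022LandauSiegel, §16]
-/

noncomputable section

open Complex Real ComplexConjugate Filter Topology
open Literature.NumberTheory.LFunctions.Zhang2022
open Literature.NumberTheory.LFunctions.Zhang2022.Skeleton

namespace Literature.NumberTheory.LFunctions.Zhang2022.Typed.Section16A

/-! ## Glue: `β_j = i b_j` (the skeleton's complex shifts vs. the tree's real shift sizes) -/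

/-- `β₁ = i·b₁` ((2.13); `Skeleton.beta1` vs `Skeleton.b1`), so that the tree's `MeanSquareMajorant.kappa₂
(b1 c′ D)` — **`κ₂`, "`Σ_n κ₂(n)n^{−s} = ζ(s+β₁)/ζ(s)`, `σ > 1`", node `Z22:§16.u006` [Z22 p.89, tex L4430],
CITED not re-declared, its identity being the tree theorem `MeanSquareMajorant.LSeries_kappa₂`** — is the
`κ₂` of §16. [cite: Zhang2022LandauSiegel, §2 (2.13), §16 p.89 (u006)] -/
theorem beta1_eq_b1_mul_I (c' : ℝ) (D : ℕ) : beta1 c' D = (b1 c' D : ℂ) * I := by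
  simp only [beta1, b1]; push_cast; ring

/-- `β₂ = i·b₂` ((2.13); `Skeleton.beta2` vs `Skeleton.b2`). [cite: Zhang2022LandauSiegel, §2 (2.13)] -/
theorem beta2_eq_b2_mul_I (c' : ℝ) (D : ℕ) : beta2 c' D = (b2 c' D : ℂ) * I := by
  simp only [beta2, b2]; push_cast; ring

/-- `β₃ = i·b₃` ((2.13); `Skeleton.beta3` vs `Skeleton.b3`). [cite: Zhang2022LandauSiegel, §2 (2.13)] -/
theorem beta3_eq_b3_mul_I (c' : ℝ) (D : ℕ) : beta3 c' D = (b3 c' D : ℂ) * I := by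
  simp only [beta3, b3]; push_cast; ring

/-! ## §16 p. 88: `𝒦₂(s,ψ)`, `I₃^±(ψ)` and the opening reductions (u001–u005) -/

section Opening

variable (c' : ℝ) {D : ℕ} [NeZero D] (χ : DirichletCharacter ℂ D) (x : Chr D)

/-- **`𝒦₂(s,ψ) = Z(s,χψ)⁻¹ · L(s+β₁,ψ)/L(s,ψ) · B(s,ψ)N(s+β₃,ψ)K(1−s−β₂,ψ̄)`** ("Recall that `Φ₂` is given
by (13.9). Write …"; = the skeleton's `𝔨*₂(ρ,ψ)` (13.5) `Skeleton.kstar2` with `L(s,ψ)` in place of `L′(ρ,ψ)`).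
Node `Z22:§16.u001` [Z22 p.88, tex L4404]. [cite: Zhang2022LandauSiegel, §16 p.88 (u001)] -/
def calK2 (s : ℂ) : ℂ :=
  (Zpc χ x s)⁻¹ * (x.ψ.LFunction (s + beta1 c' D) / x.ψ.LFunction s) * Bpoly χ x s *
    Nchar D (psiFn x) (s + beta3 c' D) * Kchar D (psiBarFn x) (1 - s - beta2 c' D)

/-- **`I₃^±(ψ) = (1/2πi)∫_{𝔍(±α)} 𝒦₂(s,ψ)ω(s) ds`**, typed as the segment integral over `𝔍(a)`
(`= [s₀+a−i𝓛₁, s₀+a+i𝓛₁]`, §7 p. 33) for a real abscissa `a`: `I₃⁺ = I3pm … (α)`, `I₃⁻ = I3pm … (−α)`; (16.1)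
uses the same integrand on `𝔍(1)`. Node `Z22:§16.u003` [Z22 p.88, tex L4412].
[cite: Zhang2022LandauSiegel, §16 p.88 (u003)] -/
def I3pm (a : ℝ) : ℂ := Lemma81.segInt (t0 D) (ell1 D) (a : ℂ) fun s => calK2 c' χ x s * omegaW D s

/-- **"Similar to (15.3), `Φ₂ = Σ_{ψ∈Ψ₁}(p_ψt₀)^{β₁}(I₃⁺(ψ) − I₃⁻(ψ)) + O(ε)`"** (`ε = exp{−c𝓛¹⁰}`).
Node `Z22:§16.u002` [Z22 p.88, tex L4408]; cites (15.3). CLAIM. [cite: Zhang2022LandauSiegel, §16 p.88 (u002)] -/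
def Step16_u002 : Prop :=
  ∃ c : ℝ, 0 < c ∧ ∃ C : ℝ, ForAllLarge fun D _ χ => AssumptionA D χ →
    ‖Phi2 c' χ - ∑ x ∈ finsetOf (PsiOne χ),
        (((x.p : ℝ) * t0 D : ℝ) : ℂ) ^ beta1 c' D * (I3pm c' χ x (alpha D) - I3pm c' χ x (-alpha D))‖ ≤
      C * Real.exp (-c * ell D ^ 10)

/-- **"For `ψ ∈ Ψ₁`, moving the segment `𝔍(−α)` to `𝔍(−𝓛⁹)` we obtain, by simple estimation,
`I₃⁻(ψ) ≪ ε`"** (preceded by "Note that the length of the sum `B(s,ψ)N(s+β₃,ψ)` is `≤ PT⁻¹`").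
Node `Z22:§16.u004` [Z22 p.89, tex L4417]. CLAIM. [cite: Zhang2022LandauSiegel, §16 p.89 (u004)] -/
def Step16_u004 : Prop :=
  ∃ c : ℝ, 0 < c ∧ ∃ C : ℝ, ForAllLarge fun D _ χ => AssumptionA D χ →
    ∀ x ∈ PsiOne χ, ‖I3pm c' χ x (-alpha D)‖ ≤ C * Real.exp (-c * ell D ^ 10)

/-- **"Hence `Φ₂ = Σ_{ψ∈Ψ₁}(p_ψt₀)^{β₁}I₃⁺(ψ) + O(ε)`"**. Node `Z22:§16.u005` [Z22 p.89, tex L4421]. CLAIM.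
[cite: Zhang2022LandauSiegel, §16 p.89 (u005)] -/
def Step16_u005 : Prop :=
  ∃ c : ℝ, 0 < c ∧ ∃ C : ℝ, ForAllLarge fun D _ χ => AssumptionA D χ →
    ‖Phi2 c' χ - ∑ x ∈ finsetOf (PsiOne χ),
        (((x.p : ℝ) * t0 D : ℝ) : ℂ) ^ beta1 c' D * I3pm c' χ x (alpha D)‖ ≤
      C * Real.exp (-c * ell D ^ 10)

/-- **(16.1)**: "In a way similar to the proof of (15.6), we can move the segment `𝔍(α)` to `𝔍(1)` and
then extend the sum over `Ψ₁` to that over `Ψ` with an acceptable error. Hence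
`Φ₂ = Σ_{p∼P}(pt₀)^{β₁} Σ*_{ψ (mod p)} (1/2πi)∫_{𝔍(1)} 𝒦₂(s,ψ)ω(s)ds + o(𝔓)`" (the double sum over
all primitive `ψ` to moduli `p ∼ P` = `∑ᶠ` over the finite type `Chr D`). Node `Z22:(16.1)`
[Z22 p.89, (16.1), tex L4425]; cites (15.6). CLAIM. [cite: Zhang2022LandauSiegel, §16 (16.1) p.89] -/
def Eq16_1 : Prop :=
  ∀ ε : ℝ, 0 < ε → ForAllLarge fun D _ χ => AssumptionA D χ →
    ‖Phi2 c' χ - ∑ᶠ x : Chr D, (((x.p : ℝ) * t0 D : ℝ) : ℂ) ^ beta1 c' D * I3pm c' χ x 1‖ ≤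
      ε * frakP D

end Opening

/-! ## §16 p. 89: the coefficient sequences `κ₂`, `b₁`, `g̃₂` and Proposition 14.1 (u006–u010, (16.2), (16.3)) -/

section Coefficients

variable (c' : ℝ) (D : ℕ)

/-- **§16's `g̃₂(y) = y^{β₂}g*(P₄/y)`** (`g*` = `Skeleton.gstar`, `P₄` = `Skeleton.P4`). PRINT: the symbol
`g̃₂` is also used in §11 for a different weight (`Skeleton.gtilde2`); this is the §16 one (parallel to
§15's `g̃₃(y) = y^{β₃}g*(P₄/y)`; named `gTilde16` to keep clear of that homonym). Vanishes for
`y ≥ 2P₄`. Node `Z22:§16.u009` [Z22 p.89, tex L4441]. [cite: Zhang2022LandauSiegel, §16 p.89 (u009)] -/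
def gTilde16 (y : ℝ) : ℂ := (y : ℂ) ^ beta2 c' D * (gstar D (P4 D / y) : ℂ)

/-- **`κ₂`**: "Let `κ₂(n)` … be given by `Σ_n κ₂(n)n^{−s} = ζ(s+β₁)/ζ(s)`, `σ > 1`" — the TREE's
`MeanSquareMajorant.kappa₂` (Dirichlet convolution `n^{−β₁} ∗ μ`, `Section14MeanSquareMajorant`) at the
shift size `b₁` of (2.13) (`β₁ = ib₁`, `beta1_eq_b1_mul_I`); its printed generating identity is the tree
THEOREM `MeanSquareMajorant.LSeries_kappa₂` — cited, not re-typed. This decl only fixes the `(c′, D)`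
parametrisation (L4 naming, mirror of `kappa1` in `TypedSection15B`). Node `Z22:§16.u006`
[Z22 p.89, tex L4430]. [cite: Zhang2022LandauSiegel, §16 p.89 (u006)] -/
def kappa2 : ArithmeticFunction ℂ := MeanSquareMajorant.kappa₂ (b1 c' D)

variable {D} [NeZero D] (χ : DirichletCharacter ℂ D)

/-- **`b₁(n)`**: "… and `b₁(n)` be given by `Σ_n b₁(n)ψ(n)n^{−s} = B(s,ψ)N(s+β₃,ψ)`". With
`B(s,ψ) = Σ_m b(m)ψχ(m)m^{−s}` (15.1) (`b` = `Skeleton.bcoef`) and `N(s+β₃,ψ) = Σ_l ψ(l)l^{−s−β₃}g*(T²/l)`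
(§6, `Skeleton.Nchar`), `ψ` completely multiplicative, the display forces, for `(n,p) = 1`,
`b₁(n) = Σ_{n=lm} l^{−β₃}g*(T²/l)·b(m)χ(m)` — DEFINED here by that convolution for every `n` (for `p ∣ n`
the display leaves `b₁(n)` free since `ψ(n) = 0`; all `n` in use are `< p`). Finite support, from the
definitions of `Skeleton.bcoef` (`b(m) = 0` unless `m < P^{1/2}·P₂ = PT⁻¹⁰`) and `g*` (`g*(T²/l) = 0` for
`l ≥ 2T²`): `b₁(n) = 0` unless `n < 2PT⁻⁸`, in particular for `n ≥ P` (the printed support bound (15.2),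
`b(n) = 0` for `n > PT⁻²η₊`, is weaker than what the definition gives) — so every `b₁`-sum below is typed
over `Finset.Ico 1 ⌈P⌉`, the range of `Skeleton.Lemma151`. PRINT / χ-BOOKKEEPING (GAP row G-L4t1-1,
the `χ`-twist family of `b`, ruling sz-L4-lead 2026-08-25T23:41Z: the discharge lane uses this χ-twisted
reading): the factor `χ(m)` comes from (15.1); the later display of §16 p.93 (tex L4608) writing
`b₁(n₁n) = ΣΣ(l₁l)^{−β₃}g*(T²/(l₁l))b(m₁m)` shows no `χ` (node `Z22:§16.u032` of `TypedSection16B`, typed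
there over this `b1coef` and flagged as not following literally). The printed identity itself is
`Eq16_u007`. Node `Z22:§16.u007` [Z22 p.89, tex L4433]. [cite: Zhang2022LandauSiegel, §16 p.89 (u007)] -/
def b1coef (n : ℕ) : ℂ :=
  ∑ q ∈ n.divisorsAntidiagonal,
    ((q.1 : ℂ) ^ (-beta3 c' D) * (gstar D (bigT D ^ 2 / q.1) : ℂ)) * (bcoef D q.2 * χ (q.2 : ZMod D))

/-- **`κ₂* = κ₂ ∗ b₁`** ("We can rewrite (16.1) as `Φ₂ = Θ₂(β₁,𝐤₂*,𝐚₂*) + o(p)` with `κ₂* = κ₂∗b₁` and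
`a₂* = g̃₂`"), with `κ₂ = kappa2 c′ D` (the tree's `MeanSquareMajorant.kappa₂`) and the tree's Dirichlet
convolution `MeanSquareMajorant.conv` (so that `MeanSquareMajorant.LSeries_twist_conv_kappa₂` and the (16.1)-majorant
`sum_norm_kappa₂_conv_sq_div_le` speak about this sequence). Node `Z22:§16.u010` (object part)
[Z22 p.89, tex L4445]. [cite: Zhang2022LandauSiegel, §16 p.89 (u010)] -/
def kappa2Star : ℕ → ℂ := MeanSquareMajorant.conv (kappa2 c' D) (b1coef c' χ)

/-- **u007 as printed**: "`Σ_n b₁(n)ψ(n)n^{−s} = B(s,ψ)N(s+β₃,ψ)`" for the object `b1coef` (a finite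
Dirichlet series; `B` = `Skeleton.Bpoly`, `N(·,ψ)` = `Skeleton.Nchar D (psiFn x)`), for every `ψ ∈ Ψ`; it
presupposes (15.1) `B(s,ψ) = Σ b(n)ψχ(n)n^{−s}` (node of `TypedSection15A`). Node `Z22:§16.u007` (identity
part) [Z22 p.89, tex L4433]. CLAIM. [cite: Zhang2022LandauSiegel, §16 p.89 (u007)] -/
def Eq16_u007 : Prop :=
  ForAllLarge fun D _ χ => ∀ x : Chr D, ∀ s : ℂ,
    ∑ n ∈ Finset.Ico 1 ⌈bigP D⌉₊, b1coef c' χ n * x.ψ (n : ZMod x.p) * (n : ℂ) ^ (-s) =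
      Bpoly χ x s * Nchar D (psiFn x) (s + beta3 c' D)

/-- **u008**: "Note that `K(1−s−β₂,ψ̄) = Σ_n g̃₂(n)ψ̄(n)/n^{1−s}` with `g̃₂(y) = y^{β₂}g*(P₄/y)`"
(`K(·,ψ̄)` = `Skeleton.Kchar D (psiBarFn x)`, a finite sum over `n < 2P₄`). Node `Z22:§16.u008`
[Z22 p.89, tex L4437]. CLAIM (definitional). [cite: Zhang2022LandauSiegel, §16 p.89 (u008)] -/
def Step16_u008 : Prop :=
  ∀ (D : ℕ) (x : Chr D) (s : ℂ),
    Kchar D (psiBarFn x) (1 - s - beta2 c' D) =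
      ∑ n ∈ Finset.Ico 1 ⌈2 * P4 D⌉₊, gTilde16 c' D n * psiBarFn x n / (n : ℂ) ^ (1 - s)

/-- **u010**: "We can rewrite (16.1) as `Φ₂ = Θ₂(β₁,𝐤₂*,𝐚₂*) + o(p)` with `κ₂* = κ₂∗b₁` and `a₂* = g̃₂`"
(`Θ₂` = `Skeleton.Theta2`, summed over `Ψ₁`). PRINT: "`o(p)`" (tex `o(p)`); no `p` is in scope for the
full sum `Φ₂`, and the neighbouring (16.1)/(16.2) carry `o(𝔓)` (tex `o(\p)`) — typed with `𝔓` and flagged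
here. Node `Z22:§16.u010` [Z22 p.89, tex L4445]; cites (16.1). CLAIM.
[cite: Zhang2022LandauSiegel, §16 p.89 (u010)] -/
def Step16_u010 : Prop :=
  ∀ ε : ℝ, 0 < ε → ForAllLarge fun D _ χ => AssumptionA D χ →
    ‖Phi2 c' χ - Theta2 χ (beta1 c' D) (kappa2Star c' χ) (fun n => gTilde16 c' D n)‖ ≤
      ε * frakP D

/-- **`Φ₂(p)`** (16.3):
`Φ₂(p) = φ(D)⁻¹ Σ_k μχ(k)/(kφ(k)) Σ_d g̃₂(dk)/d Σ_{(l,k)=1} (κ₂∗b₁)(dl)χ(l)Δ(l/(Dpk))`, in the printed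
order; `k, d` over `1 ≤ k, d ≤ 2P₄` (`g̃₂(dk) = 0` for `dk ≥ 2P₄`; the ranges of `Skeleton.main141`), the
`l`-sum a series, `Δ` = `Skeleton.DeltaW`. Equals the `p`-summand of `Skeleton.main141 χ β₁ κ₂* g̃₂` without
its factor `(pt₀)^{β₁}` after exchanging the two finite sums. Node `Z22:(16.3)` [Z22 p.89, (16.3), tex L4453].
[cite: Zhang2022LandauSiegel, §16 (16.3) p.89] -/
def Phi2p (p : ℕ) : ℂ :=
  (Nat.totient D : ℂ)⁻¹ *
    ∑ k ∈ Finset.Icc 1 ⌊2 * P4 D⌋₊,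
      (ArithmeticFunction.moebius k : ℂ) * χ (k : ZMod D) / ((k : ℂ) * Nat.totient k) *
        ∑ d ∈ Finset.Icc 1 ⌊2 * P4 D⌋₊, gTilde16 c' D ((d * k : ℕ) : ℝ) / (d : ℂ) *
          ∑' l : ℕ, if Nat.Coprime l k then
            kappa2Star c' χ (d * l) * χ (l : ZMod D) * DeltaW D ((l : ℝ) / ((D : ℝ) * p * k)) else 0

/-- **(16.2)**: "It follows by Proposition 14.1 that `Φ₂ = Σ_{p∼P}(pt₀)^{β₁}Φ₂(p) + o(𝔓)`"
(`Skeleton.Prop141` at `β = β₁`, `𝐤* = κ₂*`, `𝐚* = g̃₂`). Node `Z22:(16.2)` [Z22 p.89, (16.2), tex L4449];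
cites Prop14.1. CLAIM. [cite: Zhang2022LandauSiegel, §16 (16.2) p.89] -/
def Eq16_2 : Prop :=
  ∀ ε : ℝ, 0 < ε → ForAllLarge fun D _ χ => AssumptionA D χ →
    ‖Phi2 c' χ - ∑ p ∈ primeWindow D, (((p : ℝ) * t0 D : ℝ) : ℂ) ^ beta1 c' D * Phi2p c' χ p‖ ≤
      ε * frakP D

end Coefficients

/-! ## §16 pp. 89–91: the `l`-sum via the Mellin transform, `κ̃₂`, `λ₂`, `ℛ₂*` (u011–u018) -/

section MellinStep

variable (c' : ℝ) {D : ℕ} [NeZero D] (χ : DirichletCharacter ℂ D)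

/-- **u011** ("Similar to (7.17)"): for the `d, k` of (16.3),
`Σ_{(l,k)=1}(κ₂∗b₁)(dl)χ(l)Δ(l/(Dpk)) = Σ_{d=d₁d₂} Σ_{(l₂,k)=1} b₁(d₂l₂)χ(l₂) Σ_{(l₁,d₂k)=1} κ₂(d₁l₁)χ(l₁)Δ(l₁l₂/(Dpk))`
(an exact rearrangement of absolutely convergent series; the `l₂`-sum is finite by the support of `b₁`,
typed over `l₂ < P`). Node `Z22:§16.u011` [Z22 p.89, tex L4460]; cites (7.17). CLAIM.
[cite: Zhang2022LandauSiegel, §16 p.89 (u011)] -/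
def Step16_u011 : Prop :=
  ForAllLarge fun D _ χ => ∀ p ∈ primeWindow D, ∀ d k : ℕ, 1 ≤ d → 1 ≤ k →
    (∑' l : ℕ, if Nat.Coprime l k then
        kappa2Star c' χ (d * l) * χ (l : ZMod D) * DeltaW D ((l : ℝ) / ((D : ℝ) * p * k)) else 0) =
      ∑ e ∈ d.divisorsAntidiagonal,
        ∑ l₂ ∈ (Finset.Ico 1 ⌈bigP D⌉₊).filter (fun l₂ => Nat.Coprime l₂ k),
          b1coef c' χ (e.2 * l₂) * χ (l₂ : ZMod D) *
            ∑' l₁ : ℕ, if Nat.Coprime l₁ (e.2 * k) then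
              kappa2 c' D (e.1 * l₁) * χ (l₁ : ZMod D) *
                DeltaW D (((l₁ * l₂ : ℕ) : ℝ) / ((D : ℝ) * p * k)) else 0

/-- The Dirichlet series **`Σ_{(l₁,m)=1} κ₂(d₁l₁)χ(l₁)l₁^{−s}`** appearing in (16.4) (there `m = d₂k`).
[cite: Zhang2022LandauSiegel, §16 (16.4) p.90] -/
def kap2Ser (d₁ m : ℕ) (s : ℂ) : ℂ :=
  ∑' l : ℕ, if Nat.Coprime l m then
    kappa2 c' D (d₁ * l) * χ (l : ZMod D) / (l : ℂ) ^ s else 0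

/-- The integrand of **(16.4)** at `s`: `(Σ_{(l₁,m)=1} κ₂(d₁l₁)χ(l₁)/l₁^s)·y^s·δ(s)` (`m = d₂k`,
`y = Dpk/l₂`; `δ` = `Skeleton.deltaW`, the Mellin transform (5.14) of `Δ`).
[cite: Zhang2022LandauSiegel, §16 (16.4) p.90] -/
def integrand16_4 (d₁ m : ℕ) (y : ℝ) (s : ℂ) : ℂ := kap2Ser c' χ d₁ m s * (y : ℂ) ^ s * deltaW D s

/-- **(16.4)**: "The innermost sum is, by the Mellin transform, equal to
`(1/2πi)∫_{(2)} (Σ_{(l₁,d₂k)=1} κ₂(d₁l₁)χ(l₁)/l₁^s)(Dpk/l₂)^s δ(s) ds`" (the line `Re s = 2`, written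
`(1/2π)∫_ℝ [integrand](2 + it) dt`). Node `Z22:(16.4)` [Z22 p.90, (16.4), tex L4466]. CLAIM.
[cite: Zhang2022LandauSiegel, §16 (16.4) p.90] -/
def Eq16_4 : Prop :=
  ForAllLarge fun D _ χ => ∀ p ∈ primeWindow D, ∀ d₁ d₂ k l₂ : ℕ, 1 ≤ d₁ → 1 ≤ d₂ → 1 ≤ k → 1 ≤ l₂ →
    (∑' l₁ : ℕ, if Nat.Coprime l₁ (d₂ * k) then
        kappa2 c' D (d₁ * l₁) * χ (l₁ : ZMod D) *
          DeltaW D (((l₁ * l₂ : ℕ) : ℝ) / ((D : ℝ) * p * k))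
      else 0) =
      (1 / (2 * π) : ℂ) * ∫ t : ℝ, integrand16_4 c' χ d₁ (d₂ * k) ((D : ℝ) * p * k / l₂) (2 + t * I)

open scoped Classical in
/-- **`κ̃₂(d₁;r,s) = Σ_{h∈𝔫(d₁),(h,r)=1} κ₂(d₁h)χ(h)h^{−s}`** (`𝔫(d)` = `Skeleton.nset`: every prime factor of
`h` divides `d`); "we shall write `κ̃₂(m;r)` for `κ̃₂(m;r,1)`". Node `Z22:§16.u013` [Z22 p.90, tex L4475].
[cite: Zhang2022LandauSiegel, §16 p.90 (u013)] -/
def kappaTilde2 (d₁ r : ℕ) (s : ℂ) : ℂ :=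
  ∑' h : ℕ, if h ∈ nset d₁ ∧ Nat.Coprime h r then
    kappa2 c' D (d₁ * h) * χ (h : ZMod D) / (h : ℂ) ^ s else 0

/-- **`λ₂(n,s) = ∏_{q∣n} (1 − χ(q)q^{−s−β₁})/(1 − χ(q)q^{−s})`** ("`λ₂(n)` for `λ₂(n,1)`"). Node
`Z22:§16.u014` [Z22 p.90, tex L4479]. [cite: Zhang2022LandauSiegel, §16 p.90 (u014)] -/
def lam2 (n : ℕ) (s : ℂ) : ℂ :=
  ∏ q ∈ n.primeFactors,
    (1 - χ (q : ZMod D) * (q : ℂ) ^ (-(s + beta1 c' D))) / (1 - χ (q : ZMod D) * (q : ℂ) ^ (-s))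

/-- **u012**: "For `σ > 1`, `Σ_{(l₁,d₂k)=1} κ₂(d₁l₁)χ(l₁)/l₁^s = κ̃₂(d₁;d₂k,s)λ₂(d₁d₂k,s)L(s+β₁,χ)/L(s,χ)`"
(stated for `m = d₂k`, any `d₁, m ≥ 1`). Node `Z22:§16.u012` [Z22 p.90, tex L4470]. CLAIM.
[cite: Zhang2022LandauSiegel, §16 p.90 (u012)] -/
def Step16_u012 : Prop :=
  ∀ (D : ℕ) [NeZero D] (χ : DirichletCharacter ℂ D), χ.IsQuadratic → χ.IsPrimitive →
    ∀ d₁ m : ℕ, 1 ≤ d₁ → 1 ≤ m → ∀ s : ℂ, 1 < s.re →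
      kap2Ser c' χ d₁ m s =
        kappaTilde2 c' χ d₁ m s * lam2 c' χ (d₁ * m) s * (χ.LFunction (s + beta1 c' D) / χ.LFunction s)

/-- **`ℛ₂* = (L(1+β₁,χ)/L′(1,χ))·δ(1)`** (`δ` = `Skeleton.deltaW`). Node `Z22:§16.u016`
[Z22 p.90, tex L4490]. [cite: Zhang2022LandauSiegel, §16 p.90 (u016)] -/
def calR2star : ℂ := χ.LFunction (1 + beta1 c' D) / deriv χ.LFunction 1 * deltaW D 1

/-- **u015**: "Note that `Dpk/l₂ > T` if `l₂ < P₂²`. In a way similar to the treatment of (7.19) … the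
expression (16.4) is equal to the residue of the integrand at `s = ρ̃` plus an acceptable error. Further,
by (5.15), we can replace `ρ̃` by `1` … Thus
`Σ_{(l₁,d₂k)=1} κ₂(d₁l₁)χ(l₁)Δ(l₁l₂/(Dpk)) = ℛ₂*(Dpk/l₂)κ̃₂(d₁;d₂k)λ₂(d₁d₂k) + O(α¹⁰⁰τ₂(d₁)Dpk/l₂)`"
(typed for the variables of the enclosing sums: `p ∼ P`, `l₂ < P₂²` as printed, `d₁d₂k < 2P₄` from (16.3);
`ρ̃` is the exceptional zero of Lemma 5.5). Node `Z22:§16.u015` [Z22 p.90, tex L4484]; cites (7.19), (16.4),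
(5.15). CLAIM. [cite: Zhang2022LandauSiegel, §16 p.90 (u015)] -/
def Step16_u015 : Prop :=
  ∃ C : ℝ, ForAllLarge fun D _ χ => AssumptionA D χ →
    ∀ p ∈ primeWindow D, ∀ d₁ d₂ k l₂ : ℕ, 1 ≤ d₁ → 1 ≤ d₂ → 1 ≤ k → 1 ≤ l₂ →
      (l₂ : ℝ) < Skeleton.P2 D ^ 2 → ((d₁ * d₂ * k : ℕ) : ℝ) < 2 * P4 D →
      ‖(∑' l₁ : ℕ, if Nat.Coprime l₁ (d₂ * k) then
            kappa2 c' D (d₁ * l₁) * χ (l₁ : ZMod D) *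
              DeltaW D (((l₁ * l₂ : ℕ) : ℝ) / ((D : ℝ) * p * k))
          else 0) -
          calR2star c' χ * (((D : ℝ) * p * k / l₂ : ℝ) : ℂ) * kappaTilde2 c' χ d₁ (d₂ * k) 1 *
            lam2 c' χ (d₁ * d₂ * k) 1‖ ≤
        C * alpha D ^ 100 * d₁.divisors.card * ((D : ℝ) * p * k / l₂)

/-- **u017**: "This yields
`Σ_{(l,k)=1}(κ₂∗b₁)(dl)χ(l)Δ(l/(Dpk)) = ℛ₂*Dpk Σ_{d=d₁d₂} κ̃₂(d₁;d₂k)λ₂(dk) Σ_{(l₂,k)=1} b₁(d₂l₂)χ(l₂)/l₂ + O(α⁵⁰τ₃(d)Dpk)`"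
(for the `d, k` of (16.3): `dk < 2P₄`; `τ₃ = ζ∗ζ∗ζ`; the `l₂`-sum finite, typed over `l₂ < P`). Node
`Z22:§16.u017` [Z22 p.90, tex L4494]. CLAIM. [cite: Zhang2022LandauSiegel, §16 p.90 (u017)] -/
def Step16_u017 : Prop :=
  ∃ C : ℝ, ForAllLarge fun D _ χ => AssumptionA D χ →
    ∀ p ∈ primeWindow D, ∀ d k : ℕ, 1 ≤ d → 1 ≤ k → ((d * k : ℕ) : ℝ) < 2 * P4 D →
      ‖(∑' l : ℕ, if Nat.Coprime l k then
            kappa2Star c' χ (d * l) * χ (l : ZMod D) * DeltaW D ((l : ℝ) / ((D : ℝ) * p * k)) else 0) -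
          calR2star c' χ * ((D : ℝ) * p * k : ℝ) *
            ∑ e ∈ d.divisorsAntidiagonal, kappaTilde2 c' χ e.1 (e.2 * k) 1 * lam2 c' χ (d * k) 1 *
              ∑ l₂ ∈ (Finset.Ico 1 ⌈bigP D⌉₊).filter (fun l₂ => Nat.Coprime l₂ k),
                b1coef c' χ (e.2 * l₂) * χ (l₂ : ZMod D) / (l₂ : ℂ)‖ ≤
        C * alpha D ^ 50 * ((ArithmeticFunction.zeta ^ 3 : ArithmeticFunction ℕ) d : ℝ) *
          ((D : ℝ) * p * k)

/-- **u018**: "Hence `Σ_d g̃₂(dk)/d Σ_{(l,k)=1}(κ₂∗b₁)(dl)χ(l)Δ(l/(Dpk))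
= ℛ₂*Dpk Σ_{d₁}Σ_{d₂} g̃₂(d₁d₂k)/(d₁d₂) κ̃₂(d₁;d₂k)λ₂(d₁d₂k) Σ_{(l₂,k)=1} b₁(d₂l₂)χ(l₂)/l₂ + O(α²⁰Dpk)`"
(for the `k` of (16.3); `d, d₁, d₂ ≤ 2P₄`). Node `Z22:§16.u018` [Z22 p.90, tex L4502]. CLAIM.
[cite: Zhang2022LandauSiegel, §16 p.90 (u018)] -/
def Step16_u018 : Prop :=
  ∃ C : ℝ, ForAllLarge fun D _ χ => AssumptionA D χ →
    ∀ p ∈ primeWindow D, ∀ k : ℕ, 1 ≤ k → (k : ℝ) < 2 * P4 D →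
      ‖(∑ d ∈ Finset.Icc 1 ⌊2 * P4 D⌋₊, gTilde16 c' D ((d * k : ℕ) : ℝ) / (d : ℂ) *
            ∑' l : ℕ, if Nat.Coprime l k then
              kappa2Star c' χ (d * l) * χ (l : ZMod D) * DeltaW D ((l : ℝ) / ((D : ℝ) * p * k)) else 0) -
          calR2star c' χ * ((D : ℝ) * p * k : ℝ) *
            ∑ d₁ ∈ Finset.Icc 1 ⌊2 * P4 D⌋₊, ∑ d₂ ∈ Finset.Icc 1 ⌊2 * P4 D⌋₊,
              gTilde16 c' D ((d₁ * d₂ * k : ℕ) : ℝ) / ((d₁ : ℂ) * d₂) *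
                kappaTilde2 c' χ d₁ (d₂ * k) 1 * lam2 c' χ (d₁ * d₂ * k) 1 *
                ∑ l₂ ∈ (Finset.Ico 1 ⌈bigP D⌉₊).filter (fun l₂ => Nat.Coprime l₂ k),
                  b1coef c' χ (d₂ * l₂) * χ (l₂ : ZMod D) / (l₂ : ℂ)‖ ≤
        C * alpha D ^ 20 * ((D : ℝ) * p * k)

end MellinStep

/-! ## §16 pp. 91–92: `𝒟₂`, `ξ₂`, `λ̃₂`, `ℳ₂`, the residues `ℛ₂ⱼ` and `𝒮₂ⱼ` ((16.5)–(16.12), u019–u026) -/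

section MainSums

variable (c' : ℝ) {D : ℕ} [NeZero D] (χ : DirichletCharacter ℂ D)

/-- **`𝒟₂(d,l) = Σ_{(k,l)=1} μχ(k)/φ(k) Σ_m κ̃₂(m;dk)λ₂(mdk)g̃₂(mdk)/m`** (after "rewriting `d`, `l` and `m`
for `d₂`, `l₂` and `d₁`"; `k, m` over `1 ≤ k, m ≤ 2P₄`, where `g̃₂(mdk)` can be non-zero). Node
`Z22:§16.u019` [Z22 p.91, tex L4513]. [cite: Zhang2022LandauSiegel, §16 p.91 (u019)] -/
def calD2 (d l : ℕ) : ℂ :=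
  ∑ k ∈ (Finset.Icc 1 ⌊2 * P4 D⌋₊).filter (fun k => Nat.Coprime k l),
    (ArithmeticFunction.moebius k : ℂ) * χ (k : ZMod D) / (Nat.totient k : ℂ) *
      ∑ m ∈ Finset.Icc 1 ⌊2 * P4 D⌋₊,
        kappaTilde2 c' χ m (d * k) 1 * lam2 c' χ (m * d * k) 1 *
          gTilde16 c' D ((m * d * k : ℕ) : ℝ) / (m : ℂ)

/-- **(16.5)** AS PRINTED: "Inserting this into (16.3) … we obtain
`Φ₂(p) = (ℛ₂*Dp/φ(D)) Σ_d Σ_l b₁(dl)χ(l)/(dl)·𝒟₂(d,l) + o(1)`" (the `d, l` sums finite by the support of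
`b₁`, typed over `d, l < P`). PRINT: the error is printed `o(1)`, whereas `Φ₂(p)` has the size of `p`
((16.12) prints `o(p)`, the parallel (15.11) `o(P)`); the `o(p)` reading is `Eq16_5P`. Node `Z22:(16.5)`
[Z22 p.91, (16.5), tex L4509]; cites (16.3). CLAIM. [cite: Zhang2022LandauSiegel, §16 (16.5) p.91] -/
def Eq16_5 : Prop :=
  ∀ ε : ℝ, 0 < ε → ForAllLarge fun D _ χ => AssumptionA D χ → ∀ p ∈ primeWindow D,
    ‖Phi2p c' χ p - calR2star c' χ * ((D : ℝ) * p : ℝ) / (Nat.totient D : ℂ) *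
        ∑ d ∈ Finset.Ico 1 ⌈bigP D⌉₊, ∑ l ∈ Finset.Ico 1 ⌈bigP D⌉₊,
          b1coef c' χ (d * l) * χ (l : ZMod D) / ((d : ℂ) * l) * calD2 c' χ d l‖ ≤ ε

/-- **(16.5), `o(p)` reading** (see `Eq16_5`): the same display with the error `o(p)`.
[cite: Zhang2022LandauSiegel, §16 (16.5) p.91] -/
def Eq16_5P : Prop :=
  ∀ ε : ℝ, 0 < ε → ForAllLarge fun D _ χ => AssumptionA D χ → ∀ p ∈ primeWindow D,
    ‖Phi2p c' χ p - calR2star c' χ * ((D : ℝ) * p : ℝ) / (Nat.totient D : ℂ) *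
        ∑ d ∈ Finset.Ico 1 ⌈bigP D⌉₊, ∑ l ∈ Finset.Ico 1 ⌈bigP D⌉₊,
          b1coef c' χ (d * l) * χ (l : ZMod D) / ((d : ℂ) * l) * calD2 c' χ d l‖ ≤ ε * p

/-- **`ξ₂(n;d,l) = Σ_{n=mk,(k,l)=1} μχ(k)k/φ(k)·κ̃₂(m;dk)`** (16.7) (`k ∣ n` coprime to `l`, `m = n/k`).
Node `Z22:(16.7)` [Z22 p.91, (16.7), tex L4521]. [cite: Zhang2022LandauSiegel, §16 (16.7) p.91] -/
def xi2 (n d l : ℕ) : ℂ :=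
  ∑ k ∈ n.divisors.filter (fun k => Nat.Coprime k l),
    (ArithmeticFunction.moebius k : ℂ) * χ (k : ZMod D) * (k : ℂ) / (Nat.totient k : ℂ) *
      kappaTilde2 c' χ (n / k) (d * k) 1

/-- **(16.6)**: "On substituting `n = mk` we can write `𝒟₂(d,l) = Σ_n λ₂(dn)g̃₂(dn)ξ₂(n;d,l)/n`"
(`n ≤ 2P₄`). Node `Z22:(16.6)` [Z22 p.91, (16.6), tex L4517]. CLAIM (exact regrouping).
[cite: Zhang2022LandauSiegel, §16 (16.6) p.91] -/
def Eq16_6 : Prop :=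
  ∀ (D : ℕ) [NeZero D] (χ : DirichletCharacter ℂ D) (d l : ℕ), 1 ≤ d → 1 ≤ l →
    calD2 c' χ d l =
      ∑ n ∈ Finset.Icc 1 ⌊2 * P4 D⌋₊,
        lam2 c' χ (d * n) 1 * gTilde16 c' D ((d * n : ℕ) : ℝ) / (n : ℂ) * xi2 c' χ n d l

/-- **`λ̃₂(n,d) = ∏_{q∣n,(q,d)=1} λ₂(q)`** (16.8) (`λ₂(q) = λ₂(q,1)`). Node `Z22:(16.8)`
[Z22 p.91, (16.8), tex L4529]. [cite: Zhang2022LandauSiegel, §16 (16.8) p.91] -/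
def lamTilde2 (n d : ℕ) : ℂ :=
  ∏ q ∈ n.primeFactors.filter (fun q => Nat.Coprime q d), lam2 c' χ q 1

/-- **u020, multiplicativity**: "It can be verified, for given `d` and `l`, that `ξ₂(n;d,l)` is a
multiplicative function of `n`" (typed: value `1` at `n = 1` and `ξ₂(mn) = ξ₂(m)ξ₂(n)` for coprime `m, n`).
Node `Z22:§16.u020` (prose part) [Z22 p.91, tex L4523]. CLAIM. [cite: Zhang2022LandauSiegel, §16 p.91 (u020)] -/
def Step16_u020mult : Prop :=
  ForAllLarge fun _ _ χ => ∀ d l : ℕ, 1 ≤ d → 1 ≤ l →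
    xi2 c' χ 1 d l = 1 ∧
      ∀ m n : ℕ, Nat.Coprime m n → xi2 c' χ (m * n) d l = xi2 c' χ m d l * xi2 c' χ n d l

/-- **u020**: "… and `𝒟₂(d,l) = λ₂(d) Σ_n λ̃₂(n,d)ξ₂(n;d,l)g̃₂(dn)/n`" (`n ≤ 2P₄`; uses
`λ₂(dn) = λ₂(d)λ̃₂(n,d)`). Node `Z22:§16.u020` [Z22 p.91, tex L4525]. CLAIM.
[cite: Zhang2022LandauSiegel, §16 p.91 (u020)] -/
def Step16_u020 : Prop :=
  ∀ (D : ℕ) [NeZero D] (χ : DirichletCharacter ℂ D) (d l : ℕ), 1 ≤ d → 1 ≤ l →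
    calD2 c' χ d l =
      lam2 c' χ d 1 * ∑ n ∈ Finset.Icc 1 ⌊2 * P4 D⌋₊,
        lamTilde2 c' χ n d * xi2 c' χ n d l * gTilde16 c' D ((d * n : ℕ) : ℝ) / (n : ℂ)

/-- The integrand of **(16.9)** at `s`:
`(Σ_n λ̃₂(n,d)ξ₂(n;d,l)/n^{1+s}) · P₄^{s+β₂}/d^s · ω₁(s+β₂)/(s+β₂)` (`ω₁(w) = exp{w²/(4𝓛³⁰)}` (§4 p. 19)
= `GaussWeight.omega1 (𝓛³⁰)`). [cite: Zhang2022LandauSiegel, §16 (16.9) p.91] -/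
def integrand16_9 (d l : ℕ) (s : ℂ) : ℂ :=
  (∑' n : ℕ, lamTilde2 c' χ n d * xi2 c' χ n d l / (n : ℂ) ^ (1 + s)) *
    ((P4 D : ℂ) ^ (s + beta2 c' D) / (d : ℂ) ^ s) *
    (GaussWeight.omega1 (ell D ^ 30) (s + beta2 c' D) / (s + beta2 c' D))

/-- **(16.9)**: "Hence, similar to (15.14),
`𝒟₂(d,l) = λ₂(d)·(1/2πi)∫_{(1)} (Σ_n λ̃₂(n,d)ξ₂(n;d,l)/n^{1+s}) P₄^{s+β₂}/d^s · ω₁(s+β₂)/(s+β₂) ds + O(ε)`"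
(the line `Re s = 1` as `(1/2π)∫_ℝ [integrand](1 + it) dt`; `ε = exp{−c𝓛¹⁰}`; (15.14) first replaces `g*`
by `g` inside `g̃` with a negligible error). Node `Z22:(16.9)` [Z22 p.91, (16.9), tex L4533]; cites
(15.14). CLAIM. [cite: Zhang2022LandauSiegel, §16 (16.9) p.91] -/
def Eq16_9 : Prop :=
  ∃ c : ℝ, 0 < c ∧ ∃ C : ℝ, ForAllLarge fun D _ χ => AssumptionA D χ →
    ∀ d l : ℕ, 1 ≤ d → 1 ≤ l → ((d * l : ℕ) : ℝ) < bigP D →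
      ‖calD2 c' χ d l -
          lam2 c' χ d 1 * ((1 / (2 * π) : ℂ) * ∫ t : ℝ, integrand16_9 c' χ d l (1 + t * I))‖ ≤
        C * Real.exp (-c * ell D ^ 10)

/-- The local series **`Σ_{r≥1} ξ₂(q^r;d,l)q^{−rs}`** of the Euler factors of `ℳ₂` (u026; the pattern of
(15.18)). [cite: Zhang2022LandauSiegel, §16 p.92 (u026)] -/
def xi2LocalSeries (q d l : ℕ) (s : ℂ) : ℂ :=
  ∑' r : ℕ, if r = 0 then 0 else xi2 c' χ (q ^ r) d l / (q : ℂ) ^ ((r : ℂ) * s)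

/-- The **Euler factor of `ℳ₂(d,l;s)` at the prime `q`**:
`(1 − q^{−s−β₁})/((1 − q^{−s})(1 − χ(q)q^{−s})) · (1 + λ̃₂(q,d) Σ_{r≥1} ξ₂(q^r;d,l)/q^{rs})` — the local
factor of `ζ(s)L(s,χ)/ζ(s+β₁)` times that of `Σ_n λ̃₂(n,d)ξ₂(n;d,l)n^{−s}` (`λ̃₂(q^r,d) = λ̃₂(q,d)`, `ξ₂`
multiplicative), exactly the shape printed for `ℳ₂*` in u026 and for `ℳ₁` in (15.18).
[cite: Zhang2022LandauSiegel, §16 p.91 (u021), p.92 (u026)] -/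
def calM2Factor (q d l : ℕ) (s : ℂ) : ℂ :=
  (1 - (q : ℂ) ^ (-(s + beta1 c' D))) / ((1 - (q : ℂ) ^ (-s)) * (1 - χ (q : ZMod D) * (q : ℂ) ^ (-s))) *
    (1 + lamTilde2 c' χ q d * xi2LocalSeries c' χ q d l s)

/-- **`ℳ₂(d,l;s)`**: "It can be verified, for `σ > 9/10`, that the function
`ℳ₂(d,l;s) := ζ(s)L(s,χ)/ζ(s+β₁) · Σ_n λ̃₂(n,d)ξ₂(n;d,l)/n^s` is analytic and it satisfies
`ℳ₂(d,l;s) ≪ ∏_{q∣dl}(1 + c/q^{9/10})`." TYPING NOTE: the printed right side converges only for `σ > 1`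
and `ℳ₂` is USED at `s = 1 − β_j` (`σ = 1`), i.e. through the continuation the sentence asserts; the object
is therefore DEFINED as the Euler product `∏'_q calM2Factor … q d l s` (absolutely convergent where the manuscript
works, and the form in which it manipulates `ℳ₂`: u026, (15.18), App. A; the L4 pattern of `calM1` in
`TypedSection15B`), the printed series is the object `calM2Series`, the printed defining identity (for
`σ > 1`) is the claim `Step16_u021 : calM2 = calM2Series`, and "is analytic for `σ > 9/10`" is
`Step16_u021an`.
Node `Z22:§16.u021` [Z22 p.91, tex L4537]. [cite: Zhang2022LandauSiegel, §16 p.91 (u021)] -/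
def calM2 (d l : ℕ) (s : ℂ) : ℂ := ∏' q : Nat.Primes, calM2Factor c' χ (q : ℕ) d l s

/-- **The printed formula of `ℳ₂(d,l;s)`**: `ζ(s)L(s,χ)/ζ(s+β₁) · Σ_n λ̃₂(n,d)ξ₂(n;d,l)/n^s`, as a
series (meaningful where it converges, `σ > 1`). Node `Z22:§16.u021` (printed-series object)
[Z22 p.91, tex L4537]. [cite: Zhang2022LandauSiegel, §16 p.91 (u021)] -/
def calM2Series (d l : ℕ) (s : ℂ) : ℂ :=
  riemannZeta s * χ.LFunction s / riemannZeta (s + beta1 c' D) *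
    ∑' n : ℕ, lamTilde2 c' χ n d * xi2 c' χ n d l / (n : ℂ) ^ s

/-- **u021 as printed** (the defining identity, in its half-plane of convergence): for `σ > 1`,
`ℳ₂(d,l;s) = ζ(s)L(s,χ)/ζ(s+β₁) · Σ_n λ̃₂(n,d)ξ₂(n;d,l)/n^s`, i.e. `calM2 = calM2Series` there. Node
`Z22:§16.u021` (identity part) [Z22 p.91, tex L4537]. CLAIM. [cite: Zhang2022LandauSiegel, §16 p.91 (u021)] -/
def Step16_u021 : Prop :=
  ForAllLarge fun _ _ χ => ∀ d l : ℕ, 1 ≤ d → 1 ≤ l → ∀ s : ℂ, 1 < s.re →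
    calM2 c' χ d l s = calM2Series c' χ d l s

/-- **u021, analyticity** ("is analytic" for `σ > 9/10`). Node `Z22:§16.u021` (analytic part)
[Z22 p.91, tex L4537–L4540]. CLAIM. [cite: Zhang2022LandauSiegel, §16 p.91 (u021)] -/
def Step16_u021an : Prop :=
  ForAllLarge fun _ _ χ => ∀ d l : ℕ, 1 ≤ d → 1 ≤ l →
    DifferentiableOn ℂ (calM2 c' χ d l) {s : ℂ | 9 / 10 < s.re}

/-- **u022**: "`ℳ₂(d,l;s) ≪ ∏_{q∣dl}(1 + c/q^{9/10})`" for `σ > 9/10` (an absolute `c`). Node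
`Z22:§16.u022` [Z22 p.91, tex L4541]. CLAIM. [cite: Zhang2022LandauSiegel, §16 p.91 (u022)] -/
def Step16_u022 : Prop :=
  ∃ c : ℝ, ∃ C : ℝ, ForAllLarge fun _ _ χ => ∀ d l : ℕ, 1 ≤ d → 1 ≤ l → ∀ s : ℂ, 9 / 10 < s.re →
    ‖calM2 c' χ d l s‖ ≤ C * ∏ q ∈ (d * l).primeFactors, (1 + c / (q : ℝ) ^ (9 / 10 : ℝ))

/-- The integrand of **u023** at `s`:
`ζ(1+s+β₁)ℳ₂(d,l;1+s)/(ζ(1+s)L(1+s,χ)) · P₄^{s+β₂}/d^s · ω₁(s+β₂)/(s+β₂)`.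
[cite: Zhang2022LandauSiegel, §16 p.92 (u023)] -/
def integrand16_u023 (d l : ℕ) (s : ℂ) : ℂ :=
  riemannZeta (1 + s + beta1 c' D) * calM2 c' χ d l (1 + s) /
      (riemannZeta (1 + s) * χ.LFunction (1 + s)) *
    ((P4 D : ℂ) ^ (s + beta2 c' D) / (d : ℂ) ^ s) *
    (GaussWeight.omega1 (ell D ^ 30) (s + beta2 c' D) / (s + beta2 c' D))

/-- **u023**: "Thus we can rewrite `𝒟₂(d,l)` as
`λ₂(d)·(1/2πi)∫_{(1)} ζ(1+s+β₁)ℳ₂(d,l;1+s)/(ζ(1+s)L(1+s,χ)) · P₄^{s+β₂}/d^s · ω₁(s+β₂)/(s+β₂) ds + O(ε)`"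
(the line `Re s = 1` as `(1/2π)∫_ℝ [integrand](1 + it) dt`). Node `Z22:§16.u023` [Z22 p.92, tex L4545].
CLAIM. [cite: Zhang2022LandauSiegel, §16 p.92 (u023)] -/
def Step16_u023 : Prop :=
  ∃ c : ℝ, 0 < c ∧ ∃ C : ℝ, ForAllLarge fun D _ χ => AssumptionA D χ →
    ∀ d l : ℕ, 1 ≤ d → 1 ≤ l → ((d * l : ℕ) : ℝ) < bigP D →
      ‖calD2 c' χ d l -
          lam2 c' χ d 1 * ((1 / (2 * π) : ℂ) * ∫ t : ℝ, integrand16_u023 c' χ d l (1 + t * I))‖ ≤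
        C * Real.exp (-c * ell D ^ 10)

/-- **The function (16.11)**: `ζ(1+s+β₁)/(ζ(1+s)L(1+s,χ)) · P₄^{s+β₂}ω₁(s+β₂)/(s+β₂)`. Node
`Z22:(16.11)` [Z22 p.92, (16.11), tex L4554]. [cite: Zhang2022LandauSiegel, §16 (16.11) p.92] -/
def F1611 (s : ℂ) : ℂ :=
  riemannZeta (1 + s + beta1 c' D) / (riemannZeta (1 + s) * χ.LFunction (1 + s)) *
    ((P4 D : ℂ) ^ (s + beta2 c' D) * GaussWeight.omega1 (ell D ^ 30) (s + beta2 c' D) /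
      (s + beta2 c' D))

/-- **`ℛ₂ⱼ`**, "`j = 1,2`, the residue of the function (16.11) at `s = −β_j`" (`β_j` = `Skeleton.betaJ`).
Both poles are simple (`ζ(1+s+β₁)` at `s = −β₁`, `(s+β₂)⁻¹` at `s = −β₂`; `β₁ ≠ β₂`), so the residue is
typed as `lim_{s→−β_j, s≠−β_j} (s + β_j)·(16.11)(s)` (`limUnder` on the punctured-neighbourhood filter;
junk if the limit fails; the L4 convention, cf. `calR1` of `TypedSection15B`). Node `Z22:(16.11)`
(object part) [Z22 p.92, tex L4552–L4556]. [cite: Zhang2022LandauSiegel, §16 (16.10)–(16.11) p.92] -/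
def calR2 (j : ℕ) : ℂ :=
  limUnder (𝓝[≠] (-betaJ c' D j)) fun s => (s + betaJ c' D j) * F1611 c' χ s

/-- **(16.10)**: "Assume `dl < P₂²`, and `(dl,D) = 1`. Note that `P₄/d > T`. In a way similar to the
proof of (15.15), we deduce that `𝒟₂(d,l) = λ₂(d) Σ_{j=1,2} ℛ₂ⱼ d^{β_j} ℳ₂(d,l;1−β_j) + O(ε₁)`"
(`ε₁ = exp{−c𝓛^{1/10}}`, §7). Node `Z22:(16.10)` [Z22 p.92, (16.10), tex L4550]; cites (15.15). CLAIM.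
[cite: Zhang2022LandauSiegel, §16 (16.10) p.92] -/
def Eq16_10 : Prop :=
  ∃ c : ℝ, 0 < c ∧ ∃ C : ℝ, ForAllLarge fun D _ χ => AssumptionA D χ →
    ∀ d l : ℕ, 1 ≤ d → 1 ≤ l → ((d * l : ℕ) : ℝ) < Skeleton.P2 D ^ 2 → Nat.Coprime (d * l) D →
      ‖calD2 c' χ d l - lam2 c' χ d 1 *
          ∑ j ∈ ({1, 2} : Finset ℕ),
            calR2 c' χ j * (d : ℂ) ^ betaJ c' D j * calM2 c' χ d l (1 - betaJ c' D j)‖ ≤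
        C * Real.exp (-c * ell D ^ (1 / 10 : ℝ))

/-- **`𝒮₂ⱼ = Σ_n b₁(n)/n Σ_{n=dl} λ₂(d)d^{β_j}χ(l)ℳ₂(d,l;1−β_j)`** (the printed `n`-sum is unrestricted and
finite by the support of `b₁` (`n < 2PT⁻⁸`); typed over `n < ⌈P⌉` as in `Skeleton.Lemma151` / `calS1` of
`TypedSection15B`). Node `Z22:§16.u024` [Z22 p.92, tex L4562]. [cite: Zhang2022LandauSiegel, §16 p.92 (u024)] -/
def calS2 (j : ℕ) : ℂ :=
  ∑ n ∈ Finset.Ico 1 ⌈bigP D⌉₊, b1coef c' χ n / (n : ℂ) *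
    ∑ e ∈ n.divisorsAntidiagonal,
      lam2 c' χ e.1 1 * (e.1 : ℂ) ^ betaJ c' D j * χ (e.2 : ZMod D) * calM2 c' χ e.1 e.2 (1 - betaJ c' D j)

/-- **(16.12)**: "Inserting this into (16,5) [sic] and substituting `n = dl` we obtain
`Φ₂(p) = (ℛ₂*Dp/φ(D)) Σ_{j=1,2} ℛ₂ⱼ𝒮₂ⱼ + o(p)`" (PRINT: "(16,5)" for (16.5)). Node `Z22:(16.12)`
[Z22 p.92, (16.12), tex L4558]. CLAIM. [cite: Zhang2022LandauSiegel, §16 (16.12) p.92] -/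
def Eq16_12 : Prop :=
  ∀ ε : ℝ, 0 < ε → ForAllLarge fun D _ χ => AssumptionA D χ → ∀ p ∈ primeWindow D,
    ‖Phi2p c' χ p - calR2star c' χ * ((D : ℝ) * p : ℝ) / (Nat.totient D : ℂ) *
        ∑ j ∈ ({1, 2} : Finset ℕ), calR2 c' χ j * calS2 c' χ j‖ ≤ ε * p

open scoped Classical in
/-- **`ℳ₂*(s)`**: "`ℳ₂*(s) = ℳ₂(1,1;s)` if `χ(2) ≠ 1`" (u025) and "`ℳ₂*(s) = 2∏_{q>2}
(1 − q^{−s−β₁})/((1 − q^{−s})(1 − χ(q)q^{−s}))·(1 + λ̃₂(q,1)Σ_r ξ₂(q^r;1,1)/q^{rs})` if `χ(2) = 1`" (u026),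
the `q > 2` product = `∏'` over all primes of `calM2Factor … q 1 1 s` with factor `1` at `q = 2`. Nodes `Z22:§16.u025`,
`Z22:§16.u026` [Z22 p.92, tex L4567, L4570]. [cite: Zhang2022LandauSiegel, §16 p.92 (u025–u026)] -/
def calM2star (s : ℂ) : ℂ :=
  if χ (2 : ZMod D) ≠ 1 then calM2 c' χ 1 1 s
  else 2 * ∏' q : Nat.Primes, if (q : ℕ) = 2 then 1 else calM2Factor c' χ (q : ℕ) 1 1 s

/-- **u026 restated on `calM2star`**: if `χ(2) = 1` then `ℳ₂*(s)` is twice the Euler product of `ℳ₂(1,1;s)`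
with the prime `2` removed (definitional). Node `Z22:§16.u026` [Z22 p.92, tex L4570]. CLAIM (by `rfl`-level
unfolding). [cite: Zhang2022LandauSiegel, §16 p.92 (u026)] -/
def Step16_u026 : Prop :=
  ∀ (D : ℕ) [NeZero D] (χ : DirichletCharacter ℂ D), χ (2 : ZMod D) = 1 → ∀ s : ℂ,
    calM2star c' χ s = 2 * ∏' q : Nat.Primes, if (q : ℕ) = 2 then 1 else calM2Factor c' χ (q : ℕ) 1 1 s

end MainSums

end Literature.NumberTheory.LFunctions.Zhang2022.Typed.Section16A
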